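import Mathlib
import Summits.ResolutionOfSingularities.ResolutionOfSingularities.Theorems.RadicialJungCleanModelsCleanProp44SigmaTowerTop
import HarnessLib

/-!
# Route `RadicialJung`, crux `CleanModels` (stmt-ResolutionOfSingularities-15917), line `Sketch` rev 35, stub 6 `stub_cleanProp44` (X44c):
# STEP 2 OF THE `δ`-DESCENT END TO END ON THE σ-TOWERS OF THE BIRTHS — ✓ `sigmaTower_top` (one closed-point tower per birth) ∘
# ✓ `birth_descent_of_exists_isLocalization`

Seat decomp-res-hand-2 g23 (structural hand); companion of ✓ `sigmaTower_successor_top` (STEP 1 at `η″`).  The births `c′_i ∈ Γ″` (`i ∈ s`) of one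
generation lie over pairwise non-associated primes `P_i(u)` of the base line; each has its own tower of CLOSED points `c ↤ z′_1 ↤ ⋯ ↤ z′_d ↤ c′_i` through the
σ-curves (the levels `< d` follow the leaf, the top point `c′_i` is any point of the `v`-chart), all over the same blowings up `τ_j : Y_{j+1} → Y_j`.  KERNEL CHECK
THAT THE PIECES FIT: the `∃ N`-clauses of ✓ `sigmaTower_top` at the births, for ANY compatible `κ[u][T]`-structures on `S_i = 𝒪_{Y_{d+1}, c′_i}/(v^{(i)}_{d+1})`,
feed ✓ `birth_descent_of_exists_isLocalization` verbatim; what remains per birth is census (S4) (`P_i(u), T + λ ∈ 𝔫_{S_i}`, the new leaf `w_i ∈ 𝔫_{S_i}`, the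
surrogate «`δ′_i ≥ d′_i`» along `K_i`) and the face data `c, λ` of STEP 1.

* `sigmaTower_birth_descent` — **STEP 2 END TO END**: `Σ_{i∈s} (d′_i − 1)·deg P_i ≤ δ − 2` and `d′_i ≤ δ − 1`.

Honest framing: OURS, composition only; nothing here proves X44c, any case of `CleanModels`, or resolution of singularities in characteristic `p`.
[cite: CossartPiltant2008, Prop. 4.4 (proof, p. 11)] [cite: CossartPiltant2009, ch.1 II.5.3.2 (i)] [cite: CossartJannsenSaito2020, Lemma 7.5]
-/

noncomputable section

set_option linter.dupNamespace false -- mandated namespace of this single-conjunct summit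

open IsLocalRing CategoryTheory AlgebraicGeometry Polynomial
open Literature.AlgebraicGeometry.Resolution

namespace Summit.ResolutionOfSingularities.ResolutionOfSingularities.Theorems.RadicialJung.CleanModels

universe u

section Births

variable (d : ℕ) (Y : ℕ → Scheme.{u}) (τ : ∀ j, Y (j + 1) ⟶ Y j) (J : ∀ j, (Y j).IdealSheafData)
  {ι : Type*} (s : Finset ι)
  -- one tower of points per birth
  (y : ι → ∀ j, Y (j + 1))
  (e : ∀ i j, (Y (j + 1)).presheaf.stalk (y i j) ≃+* (Y (j + 1)).presheaf.stalk (τ (j + 1) (y i (j + 1))))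
  (ψ : ∀ i j, (Y j).presheaf.stalk (τ j (y i j)) →+* (Y (j + 1)).presheaf.stalk (τ (j + 1) (y i (j + 1))))
  (t v : ∀ i j, (Y j).presheaf.stalk (τ j (y i j)))
  {k : Type u} [Field k] (M₀ : ι → Submonoid k[X])
  (Ψ : ∀ i j, (Y 0).presheaf.stalk (τ 0 (y i 0)) →+* (Y j).presheaf.stalk (τ j (y i j)))
  (inst₀ : ∀ i, Algebra k[X] ((Y 0).presheaf.stalk (τ 0 (y i 0)) ⧸ Ideal.span (Set.range ![t i 0, v i 0])))
  (instE : ∀ i, Algebra (k[X])[X] ((Y (d + 1)).presheaf.stalk (τ (d + 1) (y i (d + 1))) ⧸ Ideal.span {v i (d + 1)}))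
  (p : ℕ) [Fact p.Prime] [CharP k p]

set_option maxHeartbeats 800000 in
-- long statement; elaboration only
/-- **STEP 2 OF THE `δ`-DESCENT END TO END** (see the module docstring).  Tower hypotheses per birth `i` as in ✓ `sigmaTower_top`; the `κ[u][T]`-structures
`instE i` on `S_i` compatible with the base through `Ψ^{(i)}_{d+1}` and with `T ↦ t̄^{(i)}_{d+1}`; then the hypotheses of ✓ `birth_descent_of_isLocalization`
with the localization instances REPLACED by the towers. [cite: CossartPiltant2008, Prop. 4.4 (proof, p. 11)] [cite: CossartPiltant2009, ch.1 II.5.3.2 (i)] -/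
theorem sigmaTower_birth_descent
    (hτ : ∀ j < d + 1, IsBlowup (τ j) (J j))
    (hψ : ∀ i, ∀ j < d + 1, ∀ r, ψ i j r = e i j (((τ j).stalkMap (y i j)).hom r))
    (h0 : ∀ i, IsRsopPart ![t i 0, v i 0])
    (hcJ : ∀ i, ∀ j < d + 1, Ideal.span (Set.range ![t i j, v i j]) = stalkIdeal (J j) (τ j (y i j)))
    (hv : ∀ i, ∀ j < d + 1, ψ i j (v i j) = v i (j + 1)) (ht : ∀ i, ∀ j < d + 1, ψ i j (t i j) = v i (j + 1) * t i (j + 1))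
    (ht𝔪 : ∀ i, ∀ j < d, t i (j + 1) ∈ maximalIdeal ((Y (j + 1)).presheaf.stalk (τ (j + 1) (y i (j + 1)))))
    (hΨ0 : ∀ i r, Ψ i 0 r = r) (hΨ : ∀ i, ∀ j < d + 1, ∀ r, Ψ i (j + 1) r = ψ i j (Ψ i j r))
    (hloc₀ : ∀ i, @IsLocalization k[X] _ (M₀ i) ((Y 0).presheaf.stalk (τ 0 (y i 0)) ⧸ Ideal.span (Set.range ![t i 0, v i 0])) _ (inst₀ i))
    (hEC : ∀ i (g : k[X]) (r₀ : (Y 0).presheaf.stalk (τ 0 (y i 0))),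
      @algebraMap k[X] ((Y 0).presheaf.stalk (τ 0 (y i 0)) ⧸ Ideal.span (Set.range ![t i 0, v i 0])) _ _ (inst₀ i) g = Ideal.Quotient.mk _ r₀ →
      @algebraMap (k[X])[X] ((Y (d + 1)).presheaf.stalk (τ (d + 1) (y i (d + 1))) ⧸ Ideal.span {v i (d + 1)}) _ _ (instE i) (C g) =
        Ideal.Quotient.mk _ (Ψ i (d + 1) r₀))
    (hEX : ∀ i, @algebraMap (k[X])[X] ((Y (d + 1)).presheaf.stalk (τ (d + 1) (y i (d + 1))) ⧸ Ideal.span {v i (d + 1)}) _ _ (instE i) Polynomial.X =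
      Ideal.Quotient.mk _ (t i (d + 1)))
    [hSloc : ∀ i, IsLocalRing ((Y (d + 1)).presheaf.stalk (τ (d + 1) (y i (d + 1))) ⧸ Ideal.span {v i (d + 1)})]
    -- the face of STEP 1 and the births
    {c : k} (hc : c ≠ 0) {a₀ : k} (ha₀ : a₀ ≠ 0) (lam : k[X]) {μ : ℕ} (hμ : 0 < μ)
    (hlam : lam.natDegree ≤ d + 1 + 1) (hδ : ((d + 1 + 1 : ℕ) : k) = 0) (hlam' : derivative lam ≠ 0)
    (P : ι → k[X]) (hP : ∀ i, Prime (P i)) (hne : ∀ i ∈ s, ∀ j ∈ s, i ≠ j → ¬ P i ∣ P j)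
    [∀ i, (Ideal.span ({C (P i), X + C lam} : Set (k[X])[X])).IsPrime]
    -- census (S4) at each birth
    (h1 : ∀ i, @algebraMap (k[X])[X] ((Y (d + 1)).presheaf.stalk (τ (d + 1) (y i (d + 1))) ⧸ Ideal.span {v i (d + 1)}) _ _ (instE i) (C (P i)) ∈
      maximalIdeal _)
    (h2 : ∀ i, @algebraMap (k[X])[X] ((Y (d + 1)).presheaf.stalk (τ (d + 1) (y i (d + 1))) ⧸ Ideal.span {v i (d + 1)}) _ _ (instE i) (X + C lam) ∈
      maximalIdeal _)
    (G : ∀ i, (Y (d + 1)).presheaf.stalk (τ (d + 1) (y i (d + 1))) ⧸ Ideal.span {v i (d + 1)}) (d' : ι → ℕ) (hd'1 : ∀ i ∈ s, 1 ≤ d' i)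
    (hw𝔫 : ∀ i ∈ s, @algebraMap (k[X])[X] ((Y (d + 1)).presheaf.stalk (τ (d + 1) (y i (d + 1))) ⧸ Ideal.span {v i (d + 1)}) _ _ (instE i)
      (C (C a₀) * X) - G i ^ p ∈ maximalIdeal _)
    (hf : ∀ i ∈ s, @algebraMap (k[X])[X] ((Y (d + 1)).presheaf.stalk (τ (d + 1) (y i (d + 1))) ⧸ Ideal.span {v i (d + 1)}) _ _ (instE i)
        (C (C c) * (X + C lam) ^ μ) ∈
      Ideal.span {@algebraMap (k[X])[X] ((Y (d + 1)).presheaf.stalk (τ (d + 1) (y i (d + 1))) ⧸ Ideal.span {v i (d + 1)}) _ _ (instE i)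
        (C (C a₀) * X) - G i ^ p} ⊔ maximalIdeal _ ^ (μ * d' i)) :
    (∑ i ∈ s, (d' i - 1) * (P i).natDegree ≤ d + 1 + 1 - 2) ∧ ∀ i ∈ s, d' i ≤ d + 1 + 1 - 1 := by
  letI := instE
  have hN : ∀ i, ∃ N : Submonoid (k[X])[X], IsLocalization N ((Y (d + 1)).presheaf.stalk (τ (d + 1) (y i (d + 1))) ⧸ Ideal.span {v i (d + 1)}) :=
    fun i => (sigmaTower_top d Y τ J (y i) (e i) (ψ i) (t i) (v i) (M₀ i) (Ψ i) (inst₀ i) hτ (hψ i) (h0 i) (hcJ i) (hv i) (ht i) (ht𝔪 i)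
      (hΨ0 i) (hΨ i) (hloc₀ i)).2.2 (instE i) (hEC i) (hEX i)
  exact birth_descent_of_exists_isLocalization p s (fun i => (Y (d + 1)).presheaf.stalk (τ (d + 1) (y i (d + 1))) ⧸ Ideal.span {v i (d + 1)})
    hc ha₀ lam hμ hlam hδ hlam' P hP hne hN h1 h2 G d' hd'1 hw𝔫 hf

end Births

end Summit.ResolutionOfSingularities.ResolutionOfSingularities.Theorems.RadicialJung.CleanModels

end
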